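import Mathlib.Algebra.Order.BigOperators.Ring.Finset
import Mathlib.Analysis.SpecialFunctions.Log.Basic
import HarnessLib

/-!
# Doeblin's contraction for weighted averages with a common component (proved)

Topic `Literature/Analysis/Convexity`. The elementary inequality behind Doeblin-type coupling /
ratio-limit arguments (W. Doeblin 1937; in the form used for Kesten's incipient infinite cluster,
H. Kesten, PTRF 73 (1986), proof of Thm. 3, and Garban–Pete–Schramm, JAMS 26 (2013), proof of
Prop. 3.1/11: "with conditional probability at least `c` the two configurations are coupled, so the
dependence contracts geometrically"). Two probability vectors `w, w'` on a finite index set that both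
dominate `β` times a common probability vector `ν` ("overlap at least `β`") average any family of
values `r_i ∈ [m, M]` to within `(1 - β)(M - m)` of each other:

* `sum_mul_mem_Icc_of_overlap` — `∑ w_i r_i ∈ [β ν(r) + (1-β) m, β ν(r) + (1-β) M]`, `ν(r) = ∑ ν_i r_i`;
* `abs_sum_mul_sub_sum_mul_le_of_overlap` — the ADDITIVE form
  `|∑ w_i r_i - ∑ w'_i r_i| ≤ (1 - β)(M - m)`;
* `sum_mul_le_mul_sum_mul_of_overlap` — the MULTIPLICATIVE (ratio) form for positive values
  `r_i ∈ [A, B]`, `0 < A`: `∑ w_i r_i ≤ (β + (1 - β) B / A) · ∑ w'_i r_i`, i.e. the ratio of the two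
  averages exceeds `1` by at most `(1 - β)(B/A - 1)`: iterating over `N` scales, a ratio oscillation
  `B₀/A₀ - 1` contracts to `(1 - β)^N (B₀/A₀ - 1)`.

Everything is proved; no definitions.

## References

* H. Kesten, *The incipient infinite cluster in two-dimensional percolation*, Probab. Theory Related
  Fields 73 (1986) 369–394, proof of Thm. 3.
* T. Lindvall, *Lectures on the Coupling Method*, Wiley (1992), Ch. I §5 (Doeblin's coupling).
-/

open Finset

namespace Literature.Analysis.Convexity.Doeblin

variable {ι : Type*}

/-- **An average with overlap `β` on `ν` lies in `β ν(r) + (1-β)[m, M]`.** If `w ≥ β ν` termwise,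
`∑ w = 1`, `∑ ν = 1`, `0 ≤ β`, and `m ≤ r_i ≤ M`, then
`β ∑ νᵢ rᵢ + (1-β) m ≤ ∑ wᵢ rᵢ ≤ β ∑ νᵢ rᵢ + (1-β) M` (split `w = β ν + (w - β ν)`; the remainder has
nonnegative weights of total mass `1 - β`). [cite: Kesten1986, proof of Thm. 3] -/
theorem sum_mul_mem_Icc_of_overlap (s : Finset ι) (w ν r : ι → ℝ) {β m M : ℝ}
    (hw1 : ∑ i ∈ s, w i = 1) (hν1 : ∑ i ∈ s, ν i = 1)
    (hdom : ∀ i ∈ s, β * ν i ≤ w i) (hr : ∀ i ∈ s, m ≤ r i ∧ r i ≤ M) :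
    β * (∑ i ∈ s, ν i * r i) + (1 - β) * m ≤ ∑ i ∈ s, w i * r i ∧
      ∑ i ∈ s, w i * r i ≤ β * (∑ i ∈ s, ν i * r i) + (1 - β) * M := by
  -- the remainder weights
  have hsplit : ∑ i ∈ s, w i * r i =
      β * (∑ i ∈ s, ν i * r i) + ∑ i ∈ s, (w i - β * ν i) * r i := by
    rw [Finset.mul_sum, ← Finset.sum_add_distrib]
    refine Finset.sum_congr rfl fun i _ => by ring
  have hmass : ∑ i ∈ s, (w i - β * ν i) = 1 - β := by
    rw [Finset.sum_sub_distrib, ← Finset.mul_sum, hw1, hν1, mul_one]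
  have hnn : ∀ i ∈ s, 0 ≤ w i - β * ν i := fun i hi => sub_nonneg.2 (hdom i hi)
  have hlo : (1 - β) * m ≤ ∑ i ∈ s, (w i - β * ν i) * r i := by
    calc (1 - β) * m = ∑ i ∈ s, (w i - β * ν i) * m := by rw [← Finset.sum_mul, hmass]
      _ ≤ ∑ i ∈ s, (w i - β * ν i) * r i :=
          Finset.sum_le_sum fun i hi => mul_le_mul_of_nonneg_left (hr i hi).1 (hnn i hi)
  have hhi : ∑ i ∈ s, (w i - β * ν i) * r i ≤ (1 - β) * M := by
    calc ∑ i ∈ s, (w i - β * ν i) * r i ≤ ∑ i ∈ s, (w i - β * ν i) * M :=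
          Finset.sum_le_sum fun i hi => mul_le_mul_of_nonneg_left (hr i hi).2 (hnn i hi)
      _ = (1 - β) * M := by rw [← Finset.sum_mul, hmass]
  rw [hsplit]
  exact ⟨by linarith, by linarith⟩

/-- **Doeblin's contraction, additive form.** Two probability vectors `w, w'` on `s` with overlap
`β` on a probability vector `ν` (`w, w' ≥ β ν` termwise) average values `r_i ∈ [m, M]` to within
`(1 - β)(M - m)`: `|∑ wᵢ rᵢ - ∑ w'ᵢ rᵢ| ≤ (1 - β)(M - m)`. [cite: Kesten1986, proof of Thm. 3] -/
theorem abs_sum_mul_sub_sum_mul_le_of_overlap (s : Finset ι) (w w' ν r : ι → ℝ) {β m M : ℝ}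
    (hw1 : ∑ i ∈ s, w i = 1) (hw'1 : ∑ i ∈ s, w' i = 1) (hν1 : ∑ i ∈ s, ν i = 1)
    (hdom : ∀ i ∈ s, β * ν i ≤ w i) (hdom' : ∀ i ∈ s, β * ν i ≤ w' i)
    (hr : ∀ i ∈ s, m ≤ r i ∧ r i ≤ M) :
    |∑ i ∈ s, w i * r i - ∑ i ∈ s, w' i * r i| ≤ (1 - β) * (M - m) := by
  obtain ⟨h1, h2⟩ := sum_mul_mem_Icc_of_overlap s w ν r hw1 hν1 hdom hr
  obtain ⟨h3, h4⟩ := sum_mul_mem_Icc_of_overlap s w' ν r hw'1 hν1 hdom' hr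
  rw [abs_le]
  constructor <;> nlinarith

/-- **Doeblin's contraction, ratio form.** For POSITIVE values `r_i ∈ [A, B]` (`0 < A`) and
probability vectors `w, w'` with overlap `β ∈ [0, 1]` on a probability vector `ν ≥ 0`,
`∑ wᵢ rᵢ ≤ (β + (1 - β) · B / A) · ∑ w'ᵢ rᵢ`: the ratio of the two averages is at most
`1 + (1 - β)(B/A - 1)`. Iterated over `N` independent overlaps this contracts a ratio oscillation
`B₀/A₀ - 1` to `(1 - β)^N (B₀/A₀ - 1)` — the geometric decay of the dependence on the far data in
Kesten's ratio-limit theorem. [cite: Kesten1986, proof of Thm. 3] -/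
theorem sum_mul_le_mul_sum_mul_of_overlap (s : Finset ι) (w w' ν r : ι → ℝ) {β A B : ℝ}
    (hw1 : ∑ i ∈ s, w i = 1) (hw'1 : ∑ i ∈ s, w' i = 1)
    (hν0 : ∀ i ∈ s, 0 ≤ ν i) (hν1 : ∑ i ∈ s, ν i = 1)
    (hβ0 : 0 ≤ β) (hβ1 : β ≤ 1)
    (hdom : ∀ i ∈ s, β * ν i ≤ w i) (hdom' : ∀ i ∈ s, β * ν i ≤ w' i)
    (hA : 0 < A) (hr : ∀ i ∈ s, A ≤ r i ∧ r i ≤ B) :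
    ∑ i ∈ s, w i * r i ≤ (β + (1 - β) * B / A) * ∑ i ∈ s, w' i * r i := by
  obtain ⟨-, h2⟩ := sum_mul_mem_Icc_of_overlap s w ν r hw1 hν1 hdom hr
  obtain ⟨h3, -⟩ := sum_mul_mem_Icc_of_overlap s w' ν r hw'1 hν1 hdom' hr
  set V := ∑ i ∈ s, ν i * r i with hV
  -- `A ≤ V` and `A ≤ B`
  have hAB : A ≤ B := by
    -- `s` is nonempty since `∑ ν = 1`
    by_contra h
    have hs : s.Nonempty := by
      by_contra hs'
      rw [Finset.not_nonempty_iff_eq_empty] at hs'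
      rw [hs', Finset.sum_empty] at hν1
      exact zero_ne_one hν1
    obtain ⟨i, hi⟩ := hs
    exact h ((hr i hi).1.trans (hr i hi).2)
  have hVA : A ≤ V := by
    calc A = ∑ i ∈ s, ν i * A := by rw [← Finset.sum_mul, hν1, one_mul]
      _ ≤ V := Finset.sum_le_sum fun i hi => mul_le_mul_of_nonneg_left (hr i hi).1 (hν0 i hi)
  have h1β : 0 ≤ 1 - β := sub_nonneg.2 hβ1
  -- lower bound of the second average is positive
  have hden : 0 < β * V + (1 - β) * A := by
    have : A ≤ β * V + (1 - β) * A := by nlinarith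
    exact hA.trans_le this
  -- it suffices to compare the two interval endpoints
  have key : β * V + (1 - β) * B ≤ (β + (1 - β) * B / A) * (β * V + (1 - β) * A) := by
    have hBA : 0 ≤ B / A - 1 := by
      rw [sub_nonneg, le_div_iff₀ hA, one_mul]; exact hAB
    -- expand: RHS - LHS = β (1-β) (B/A - 1) (V - A) + ... ≥ 0
    have e : (β + (1 - β) * B / A) * (β * V + (1 - β) * A) - (β * V + (1 - β) * B) =
        β * (1 - β) * (B / A - 1) * V - β * (1 - β) * (B - A) := by
      field_simp
      ring
    have e2 : β * (1 - β) * (B / A - 1) * V - β * (1 - β) * (B - A) =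
        β * (1 - β) * (B / A - 1) * (V - A) := by
      field_simp
    nlinarith [mul_nonneg (mul_nonneg (mul_nonneg hβ0 h1β) hBA) (sub_nonneg.2 hVA)]
  calc ∑ i ∈ s, w i * r i ≤ β * V + (1 - β) * B := h2
    _ ≤ (β + (1 - β) * B / A) * (β * V + (1 - β) * A) := key
    _ ≤ (β + (1 - β) * B / A) * ∑ i ∈ s, w' i * r i := by
        refine mul_le_mul_of_nonneg_left h3 ?_
        have : 0 ≤ (1 - β) * B / A := div_nonneg (mul_nonneg h1β (hA.le.trans hAB)) hA.le
        linarith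

end Literature.Analysis.Convexity.Doeblin
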